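import Summits.FinalStateConjecture.FinalStateConjecture.Theorems.EIHFluxBalanceInertialRecessionSlavingAxisKernel

/-!
# Route EIHFluxBalance — `InertialRecession` (E′), stub `stub_frozenVacuumSlaving` (K1): INVERSION
# IDENTITIES for the first-variation map at axis points (the quantitative form of the kernel lemma)

Helper file for the crux `stmt-FinalStateConjecture-17403`. `…SlavingAxisKernel` proved that the `(e₀, e_ν)`
components `F_ν(P)` of the first variation `∂_{AP+d} g + g(A·,·) + g(·,A·)` (`g = Kerr.bilin M a`, `A` `η`-skew)
at three axis points have kernel = stabiliser. Here the same elimination is run with GENERAL values `F_ν(P)`: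
at an axis point `P = (t, 0, 0, z)` the rates `b = Ae₀`, `w13 = (Ae₁)³`, `w23 = (Ae₂)³`, `d` satisfy the
IDENTITIES (`z > 0`; for `z < 0` replace `z` by `|z|` and `w ↦ −w`)
`(t+z)b₁ + d¹ − a(b₂ + w23) = (z²+a²)/(2Mz) · (z F₁ − a F₂)`, `(t+z)b₂ + d² + a(b₁ + w13) = (z²+a²)/(2Mz) · (a F₁ + z F₂)`,
`b₃(2z(z²+a²) + (a²−z²)t) + (a²−z²)d³ = (z²+a²)²/(2M) · F₀`
(`axis_inversion_pos`, `axis_inversion_neg`), so that on the slab configuration of `axisKernel_slab` every rate is an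
explicit linear combination of the nine numbers `F_ν(P_k)` with coefficients rational in `(M, a, z, v₃)`
(`axisKernel_slab_explicit`): the quantitative kernel bound with no compactness argument. [folklore]
-/

set_option linter.dupNamespace false

noncomputable section

open scoped Topology
open Filter Set Function Literature.Geometry.Lorentzian Literature.Geometry.Lorentzian.Kerr

namespace Summit.FinalStateConjecture.FinalStateConjecture.Theorems.SublinearIsFree.Slaving

section Inversion

variable {M a : ℝ} (A : E4 →L[ℝ] E4) (d : E4) (hM : M ≠ 0)
  (hA : ∀ u w : E4, Minkowski.bilin (A u) w + Minkowski.bilin u (A w) = 0)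
include hM hA

/-- **Inversion identities at an axis point with `z > 0`.** See the module docstring. [folklore] -/
theorem axis_inversion_pos (P : E4) (hP1 : P 1 = 0) (hP2 : P 2 = 0) (hPz : 0 < P 3) :
    (P 0 + P 3) * A (E4.basisVector 0) 1 + d 1 - a * (A (E4.basisVector 0) 2 + A (E4.basisVector 2) 3) =
      (P 3 ^ 2 + a ^ 2) / (2 * M * P 3) *
        (P 3 * (fderiv ℝ (Kerr.bilin M a) P (A P + d) (E4.basisVector 0) (E4.basisVector 1) +
            Kerr.bilin M a P (A (E4.basisVector 0)) (E4.basisVector 1) +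
            Kerr.bilin M a P (E4.basisVector 0) (A (E4.basisVector 1))) -
          a * (fderiv ℝ (Kerr.bilin M a) P (A P + d) (E4.basisVector 0) (E4.basisVector 2) +
            Kerr.bilin M a P (A (E4.basisVector 0)) (E4.basisVector 2) +
            Kerr.bilin M a P (E4.basisVector 0) (A (E4.basisVector 2)))) ∧
    (P 0 + P 3) * A (E4.basisVector 0) 2 + d 2 + a * (A (E4.basisVector 0) 1 + A (E4.basisVector 1) 3) =
      (P 3 ^ 2 + a ^ 2) / (2 * M * P 3) *
        (a * (fderiv ℝ (Kerr.bilin M a) P (A P + d) (E4.basisVector 0) (E4.basisVector 1) +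
            Kerr.bilin M a P (A (E4.basisVector 0)) (E4.basisVector 1) +
            Kerr.bilin M a P (E4.basisVector 0) (A (E4.basisVector 1))) +
          P 3 * (fderiv ℝ (Kerr.bilin M a) P (A P + d) (E4.basisVector 0) (E4.basisVector 2) +
            Kerr.bilin M a P (A (E4.basisVector 0)) (E4.basisVector 2) +
            Kerr.bilin M a P (E4.basisVector 0) (A (E4.basisVector 2)))) ∧
    A (E4.basisVector 0) 3 * (2 * P 3 * (P 3 ^ 2 + a ^ 2) + (a ^ 2 - P 3 ^ 2) * P 0) + (a ^ 2 - P 3 ^ 2) * d 3 =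
      (P 3 ^ 2 + a ^ 2) ^ 2 / (2 * M) *
        (fderiv ℝ (Kerr.bilin M a) P (A P + d) (E4.basisVector 0) (E4.basisVector 0) +
          Kerr.bilin M a P (A (E4.basisVector 0)) (E4.basisVector 0) +
          Kerr.bilin M a P (E4.basisVector 0) (A (E4.basisVector 0))) := by
  set b1 := A (E4.basisVector 0) 1 with hb1
  set b2 := A (E4.basisVector 0) 2 with hb2
  set b3 := A (E4.basisVector 0) 3 with hb3
  set w13 := A (E4.basisVector 1) 3 with hw13
  set w23 := A (E4.basisVector 2) 3 with hw23
  have h31' : A (E4.basisVector 3) 1 = -w13 := by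
    have := skew_apply_succ_succ A hA 2 0; simpa using this
  have h32' : A (E4.basisVector 3) 2 = -w23 := by
    have := skew_apply_succ_succ A hA 2 1; simpa using this
  have h33 : A (E4.basisVector 3) 3 = 0 := by
    have := skew_apply_succ_succ A hA 2 2
    simp only [show (2 : Fin 3).succ = (3 : Fin 4) from rfl] at this
    linarith
  have hz : P 3 ≠ 0 := hPz.ne'
  obtain ⟨c0, c1, c2⟩ := axis_lie_components (M := M) (a := a) hP1 hP2 hz A hA (A P + d)
  have v1 : (A P + d) 1 = P 0 * b1 - P 3 * w13 + d 1 := by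
    simp only [PiLp.add_apply, apply_axis_point A P hP1 hP2]; simp [h31', hb1]; ring
  have v2 : (A P + d) 2 = P 0 * b2 - P 3 * w23 + d 2 := by
    simp only [PiLp.add_apply, apply_axis_point A P hP1 hP2]; simp [h32', hb2]; ring
  have v3 : (A P + d) 3 = P 0 * b3 + d 3 := by
    simp only [PiLp.add_apply, apply_axis_point A P hP1 hP2]; simp [h33, hb3]
  rw [v3] at c0; rw [v1, v2] at c1 c2
  have habs : |P 3| = P 3 := abs_of_pos hPz
  have hone : P 3 / |P 3| = 1 := by rw [habs, div_self hz]
  rw [hone, habs] at c0 c1 c2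
  have hD : P 3 ^ 2 + a ^ 2 ≠ 0 := by positivity
  refine ⟨?_, ?_, ?_⟩
  · rw [c1, c2]; field_simp; ring
  · rw [c1, c2]; field_simp; ring
  · rw [c0]; field_simp; ring

/-- **Inversion identities at an axis point with `z < 0`** (`|z| = −z`; the mirrored null covector flips the
sign of the `w`-terms). [folklore] -/
theorem axis_inversion_neg (P : E4) (hP1 : P 1 = 0) (hP2 : P 2 = 0) (hPz : P 3 < 0) :
    (P 0 - P 3) * A (E4.basisVector 0) 1 + d 1 - a * (A (E4.basisVector 0) 2 - A (E4.basisVector 2) 3) =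
      (P 3 ^ 2 + a ^ 2) / (2 * M * (-P 3)) *
        ((-P 3) * (fderiv ℝ (Kerr.bilin M a) P (A P + d) (E4.basisVector 0) (E4.basisVector 1) +
            Kerr.bilin M a P (A (E4.basisVector 0)) (E4.basisVector 1) +
            Kerr.bilin M a P (E4.basisVector 0) (A (E4.basisVector 1))) -
          a * (fderiv ℝ (Kerr.bilin M a) P (A P + d) (E4.basisVector 0) (E4.basisVector 2) +
            Kerr.bilin M a P (A (E4.basisVector 0)) (E4.basisVector 2) +
            Kerr.bilin M a P (E4.basisVector 0) (A (E4.basisVector 2)))) ∧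
    (P 0 - P 3) * A (E4.basisVector 0) 2 + d 2 + a * (A (E4.basisVector 0) 1 - A (E4.basisVector 1) 3) =
      (P 3 ^ 2 + a ^ 2) / (2 * M * (-P 3)) *
        (a * (fderiv ℝ (Kerr.bilin M a) P (A P + d) (E4.basisVector 0) (E4.basisVector 1) +
            Kerr.bilin M a P (A (E4.basisVector 0)) (E4.basisVector 1) +
            Kerr.bilin M a P (E4.basisVector 0) (A (E4.basisVector 1))) +
          (-P 3) * (fderiv ℝ (Kerr.bilin M a) P (A P + d) (E4.basisVector 0) (E4.basisVector 2) +
            Kerr.bilin M a P (A (E4.basisVector 0)) (E4.basisVector 2) +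
            Kerr.bilin M a P (E4.basisVector 0) (A (E4.basisVector 2)))) := by
  set b1 := A (E4.basisVector 0) 1 with hb1
  set b2 := A (E4.basisVector 0) 2 with hb2
  set w13 := A (E4.basisVector 1) 3 with hw13
  set w23 := A (E4.basisVector 2) 3 with hw23
  have h31' : A (E4.basisVector 3) 1 = -w13 := by
    have := skew_apply_succ_succ A hA 2 0; simpa using this
  have h32' : A (E4.basisVector 3) 2 = -w23 := by
    have := skew_apply_succ_succ A hA 2 1; simpa using this
  have hz : P 3 ≠ 0 := hPz.ne
  obtain ⟨-, c1, c2⟩ := axis_lie_components (M := M) (a := a) hP1 hP2 hz A hA (A P + d)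
  have v1 : (A P + d) 1 = P 0 * b1 - P 3 * w13 + d 1 := by
    simp only [PiLp.add_apply, apply_axis_point A P hP1 hP2]; simp [h31', hb1]; ring
  have v2 : (A P + d) 2 = P 0 * b2 - P 3 * w23 + d 2 := by
    simp only [PiLp.add_apply, apply_axis_point A P hP1 hP2]; simp [h32', hb2]; ring
  rw [v1, v2] at c1 c2
  have habs : |P 3| = -P 3 := abs_of_neg hPz
  have hone : P 3 / |P 3| = -1 := by rw [habs, div_neg, div_self hz]
  rw [hone, habs] at c1 c2
  have hD : P 3 ^ 2 + a ^ 2 ≠ 0 := by positivity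
  have hz' : -P 3 ≠ 0 := neg_ne_zero.2 hz
  refine ⟨?_, ?_⟩
  · rw [c1, c2]; field_simp; ring
  · rw [c1, c2]; field_simp; ring

end Inversion

/-- Registered carrier `slaving_axisInversion_slaving12` of the crux item (the third identity of
`axis_inversion_pos`). [folklore] -/
theorem slaving_axisInversion_slaving12 : open Literature.Geometry.Lorentzian in ∀ {M a : ℝ} (A : E4 →L[ℝ] E4) (d : E4), M ≠ 0 → (∀ u w : E4, Minkowski.bilin (A u) w + Minkowski.bilin u (A w) = 0) → ∀ (P : E4), P 1 = 0 → P 2 = 0 → 0 < P 3 → A (E4.basisVector 0) 3 * (2 * P 3 * (P 3 ^ 2 + a ^ 2) + (a ^ 2 - P 3 ^ 2) * P 0) + (a ^ 2 - P 3 ^ 2) * d 3 = (P 3 ^ 2 + a ^ 2) ^ 2 / (2 * M) * (fderiv ℝ (Kerr.bilin M a) P (A P + d) (E4.basisVector 0) (E4.basisVector 0) + Kerr.bilin M a P (A (E4.basisVector 0)) (E4.basisVector 0) + Kerr.bilin M a P (E4.basisVector 0) (A (E4.basisVector 0))) :=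
  fun A d hM hA P h1 h2 hz ↦ (axis_inversion_pos A d hM hA P h1 h2 hz).2.2

end Summit.FinalStateConjecture.FinalStateConjecture.Theorems.SublinearIsFree.Slaving
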